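import Summits.QuantumFields.BalabanUV.T4Continuum.Support.NE9GaussDensityRay
import Summits.QuantumFields.BalabanUV.T4Continuum.Support.NE9RadialShell

/-!
# NE9RadialShellMean — the cut-off shell of a 𝔤-VALUED bond variable with a NON-ZERO MEAN: a radial Gaussian shell is
LINEAR in its width UNIFORMLY IN THE MEAN (closes residual line (R-9) of row NE9; cell `pub-balaban`, T4-DAG §2 node U3 /
§6 NE9; lineage t4-ne9-p1 = prover P1, generation 21; census E32 of `t4/T4-EST-NE9-P1.md` §28; skeleton
`t4/b2b-balaban-t4-ne9-p1/SKELETON-NE9-P1.md` row X1)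

HONEST FRAMING (T4-DAG PAGE 1).  Rung (B)+1 on a FIXED finite torus with `FlowStep.BetaPertH` and (B) explicit — NOT
infinite volume, NOT a mass gap, NOT the Clay problem.  NE9 (`T4OutputRate.NE9 ∧ FadingMemory`) is a cell NEW ESTIMATE and is
NOT discharged here.  This module is elementary Gaussian measure theory (`[folklore]`); [I] = [Balaban1987RG1],
[II] = [Balaban1988RG2Cluster] are quoted for the TYPE of the cut-off only (ABSOLUTE RULE).  NOT summit progress; 0/9 → 0/9.

WHY.  Print's small-field cut-off «χ({|B′(b)| < ε₁})» ([I] (2.9) p. 266; «{B : |B| < ε₁g_k^{−1} on Y}», [II] (1.34) p. 9)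
is on a `𝔤`-VALUED bond variable; in the cut-off channel NE9-CUT of the last-coupling two-point bound
(`NE9FormGaussian.norm_formAct_sub_formAct_le_gaussian`) the bond variable is Gaussian UNDER THE TILTED MEASURE of [II] (2.23),
whose LINEAR term «−⟨B, Γ_kX⟩» (p. 17) SHIFTS ITS MEAN.  `NE9RadialShell` (gen 20) proved that a radial shell of a CENTRED
Gaussian (isotropic v1, anisotropic v1.1) is linear in its width with a threshold-independent constant, and left the non-zero
mean TYPED («avoidable by integrating the auxiliary field X first», record §27.5).  THIS MODULE removes the caveat:

  `𝒩{z : a ≤ ‖A z + μ‖ < a′} ≤ |det A|⁻¹ · ‖A‖^{m−1} · K′_m · (a′ − a)`,   `K′_m = m(1 + (2π)^{−m/2} vol B₁) + 2^{m/2}`,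

for EVERY mean `μ`, every invertible linear `A`, all real `a, a′` (`stdGaussian_affineRadialShell_le`; isotropic
`stdGaussian_radialShell_mean_le`; between the thresholds `ε₁/max(s,s′)`, `ε₁/min(s,s′)` of two couplings:
`stdGaussian_affineThresholdShell_le`, LINEAR in `ε₁|s⁻¹ − s′⁻¹|`, hence a bounded modulus in `t = g⁻²` on `]0, γ]` by
`NE9CutoffShell.inv_sub_inv_le`).  So print's order of integration in (2.23)–(2.25) may be kept: residual line (R-9) is
KERNEL in full (centred or not, isotropic or not).

THE PROOF (dimension-free, no polar coordinates, no spherical caps).  With `φ_μ = (2π)^{−m/2}e^{−‖·−μ‖²/2}` and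
`G(r) = ∫_{B_r} φ_μ = ∫_{B₁} r^m φ_μ(r•w) dw` (scaling, `setLIntegral_ball_eq_smul`), the shell mass is `G(a′) − G(a)
≤ ∫_{B₁} ∫_a^{a′} hb(r,w) dr dw` (FTC along each ray, `NE9GaussDensityRay.rayDensity_sub_le_integral`) `= ∫_a^{a′} ∫_{B₁} hb dw dr`
(Tonelli) and, scaling back, `∫_{B₁} hb(r,·) = r^{−1}∫_{B_r} φ_μ(y)(m + ‖y‖‖y − μ‖) dy ≤ m·r^{−1}∫_{B_r}φ_μ + ∫‖y − μ‖φ_μ ≤ K′_m`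
UNIFORMLY in `r > 0` and `μ` (`setLIntegral_rayBound_le`: small balls by volume, large balls by total mass; the first absolute
moment by translation invariance).  General covariance: `y = Az` costs `|det A|⁻¹` and replaces the density by the radial
`e^{−‖y‖²/(2‖A‖²)}` (as in `NE9RadialShell` v1.1), the shifted shell is re-centred by translation invariance of Lebesgue measure,
and the scale `‖A‖` is removed by `y = ‖A‖•w` (`lintegral_shell_scaledGaussDensity_le`).

References (TYPES only): [Balaban1987RG1] CMP 109 (1987) (2.9) p. 266; [Balaban1988RG2Cluster] CMP 116 (1988) (1.34) p. 9,
(2.3) p. 12, (2.23)–(2.25) p. 17.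
-/

noncomputable section

namespace Summit.QuantumFields.BalabanUV.T4Continuum.NE9RadialShellMean

open MeasureTheory ProbabilityTheory Set Real Module Metric
open scoped ENNReal RealInnerProductSpace
open Literature.Probability.Distributions
open Summit.QuantumFields.BalabanUV.T4Continuum.NE9GaussDensityRay

section Shell

variable {F : Type*} [NormedAddCommGroup F] [InnerProductSpace ℝ F] [FiniteDimensional ℝ F] [MeasurableSpace F]
  [BorelSpace F]

/-! ## §1 CORE: the shell integral of `φ_μ`, uniformly in `μ` (FTC along rays + Tonelli + the per-radius bound) -/

/-- **CORE (unit covariance, `0 ≤ a ≤ a′`)**: for every mean `μ`, `∫ 1{a ≤ ‖y‖ < a′}·φ_μ(y) dy ≤ K′_m·(a′ − a)` —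
the shell mass is `G(a′) − G(a)` with `G(r) = ∫_{B₁} r^m φ_μ(r•w) dw`; FTC along each ray bounds the integrand's increment by
`∫_a^{a′} hb(r, w) dr`; Tonelli; the per-radius bound `∫_{B₁} hb(r, ·) ≤ K′_m` of `NE9GaussDensityRay`. [folklore] -/
theorem lintegral_shell_gaussDensity_le_of_nonneg [Nontrivial F] (μ : F) {a a' : ℝ} (ha : 0 ≤ a) (haa : a ≤ a') :
    ∫⁻ y, ENNReal.ofReal (gaussDensity μ y) * (Ico a a').indicator 1 ‖y‖ ≤
      ENNReal.ofReal (meanShellConst F * (a' - a)) := by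
  set m : ℕ := finrank ℝ F with hm
  have hm1 : 1 ≤ m := Module.finrank_pos
  set f : ℝ → F → ℝ≥0∞ := fun r y => (ball (0 : F) r).indicator (fun y => ENNReal.ofReal (gaussDensity μ y)) y
    with hf
  have hfm : ∀ r, Measurable (f r) := fun r =>
    ((continuous_gaussDensity μ).measurable.ennreal_ofReal).indicator measurableSet_ball
  -- Step 1: the shell integrand is the difference of two ball indicators
  have hshell : ∀ y : F, ENNReal.ofReal (gaussDensity μ y) * (Ico a a').indicator 1 ‖y‖ = f a' y - f a y := by
    intro y
    simp only [hf]
    by_cases h1 : ‖y‖ < a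
    · have hya : y ∈ ball (0 : F) a := mem_ball_zero_iff.2 h1
      have hya' : y ∈ ball (0 : F) a' := mem_ball_zero_iff.2 (h1.trans_le haa)
      have hn : ‖y‖ ∉ Ico a a' := fun h => (not_le.2 h1) h.1
      rw [indicator_of_mem hya, indicator_of_mem hya', indicator_of_notMem hn, mul_zero, tsub_self]
    · have hya : y ∉ ball (0 : F) a := fun h => h1 (mem_ball_zero_iff.1 h)
      rw [indicator_of_notMem hya, tsub_zero]
      by_cases h2 : ‖y‖ < a'
      · have hya' : y ∈ ball (0 : F) a' := mem_ball_zero_iff.2 h2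
        have hn : ‖y‖ ∈ Ico a a' := ⟨not_lt.1 h1, h2⟩
        rw [indicator_of_mem hya', indicator_of_mem hn, Pi.one_apply, mul_one]
      · have hya' : y ∉ ball (0 : F) a' := fun h => h2 (mem_ball_zero_iff.1 h)
        have hn : ‖y‖ ∉ Ico a a' := fun h => h2 h.2
        rw [indicator_of_notMem hya', indicator_of_notMem hn, mul_zero]
  have hle : f a ≤ f a' := by
    intro y
    simp only [hf]
    exact indicator_le_indicator_of_subset (ball_subset_ball haa) (fun _ => zero_le) y
  have hfin : ∫⁻ y, f a y ≠ ∞ := by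
    refine ne_top_of_le_ne_top ENNReal.one_ne_top ?_
    calc ∫⁻ y, f a y ≤ ∫⁻ y, ENNReal.ofReal (gaussDensity μ y) :=
          lintegral_mono fun y => indicator_le_self _ _ y
      _ = 1 := lintegral_gaussDensity μ
  simp_rw [hshell]
  rw [lintegral_sub (hfm a) hfin (Filter.Eventually.of_forall hle)]
  -- Step 2: both ball integrals on the unit ball
  set ψ : ℝ → F → ℝ := fun r w => r ^ m * gaussDensity μ (r • w) with hψ
  have hψ0 : ∀ r w, 0 ≤ r → 0 ≤ ψ r w := fun r w hr => mul_nonneg (pow_nonneg hr _) (gaussDensity_pos μ _).le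
  have hball : ∀ {r : ℝ}, 0 ≤ r → ∫⁻ y, f r y = ∫⁻ w in ball (0 : F) 1, ENNReal.ofReal (ψ r w) := by
    intro r hr
    simp only [hf, hψ]
    rw [lintegral_indicator measurableSet_ball]
    rcases hr.eq_or_lt with h0 | hpos
    · rw [← h0, ball_zero, Measure.restrict_empty, lintegral_zero_measure]
      simp [zero_pow (Nat.pos_iff_ne_zero.1 hm1)]
    · exact setLIntegral_gaussDensity_ball_eq hpos μ
  rw [hball (ha.trans haa), hball ha]
  -- Step 3: difference under the integral, FTC along rays
  have hψm : ∀ r, Measurable fun w => ENNReal.ofReal (ψ r w) := by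
    intro r
    simp only [hψ]
    exact ((continuous_const.mul ((continuous_gaussDensity μ).comp (continuous_const.smul continuous_id)))).measurable.ennreal_ofReal
  calc (∫⁻ w in ball (0 : F) 1, ENNReal.ofReal (ψ a' w)) - ∫⁻ w in ball (0 : F) 1, ENNReal.ofReal (ψ a w)
      ≤ ∫⁻ w in ball (0 : F) 1, (ENNReal.ofReal (ψ a' w) - ENNReal.ofReal (ψ a w)) :=
        lintegral_sub_le' (μ := volume.restrict (ball (0 : F) 1)) _ _ (hψm a).aemeasurable
    _ ≤ ∫⁻ w in ball (0 : F) 1, ∫⁻ r in Ioc a a', ENNReal.ofReal (rayBound μ w m r) := by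
        refine lintegral_mono fun w => ?_
        rw [← ENNReal.ofReal_sub _ (hψ0 a w ha)]
        have hftc := rayDensity_sub_le_integral μ w hm1 ha haa
        have hint : IntegrableOn (rayBound μ w m) (Ioc a a') :=
          ((continuous_rayBound μ w m).integrableOn_Icc).mono_set Ioc_subset_Icc_self
        have hnn : 0 ≤ᵐ[volume.restrict (Ioc a a')] rayBound μ w m :=
          ae_restrict_of_forall_mem measurableSet_Ioc fun r hr => rayBound_nonneg μ w m (ha.trans hr.1.le)
        rw [← ofReal_integral_eq_lintegral_ofReal hint hnn, ← intervalIntegral.integral_of_le haa]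
        exact ENNReal.ofReal_le_ofReal hftc
    _ = ∫⁻ r in Ioc a a', ∫⁻ w in ball (0 : F) 1, ENNReal.ofReal (rayBound μ w m r) := by
        refine lintegral_lintegral_swap ?_
        exact ((continuous_rayBound_uncurry μ m).measurable.ennreal_ofReal).aemeasurable
    _ ≤ ∫⁻ r in Ioc a a', ENNReal.ofReal (meanShellConst F) := by
        refine setLIntegral_mono' measurableSet_Ioc fun r hr => ?_
        exact setLIntegral_rayBound_le μ (ha.trans_lt hr.1)
    _ = ENNReal.ofReal (meanShellConst F * (a' - a)) := by
        rw [setLIntegral_const, Real.volume_Ioc, ← ENNReal.ofReal_mul meanShellConst_nonneg]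

/-- **CORE, all real thresholds**: `∫ 1{a ≤ ‖y‖ < a′}·φ_μ(y) dy ≤ K′_m·(a′ − a)` for every mean `μ` and all real `a, a′`
(empty shell if `a′ ≤ a`; `a ↦ max a 0` otherwise). [folklore] -/
theorem lintegral_shell_gaussDensity_le [Nontrivial F] (μ : F) (a a' : ℝ) :
    ∫⁻ y, ENNReal.ofReal (gaussDensity μ y) * (Ico a a').indicator 1 ‖y‖ ≤
      ENNReal.ofReal (meanShellConst F * (a' - a)) := by
  by_cases haa : a' ≤ max a 0
  · -- empty shell (no `y` has `a ≤ ‖y‖ < a′`)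
    have h0 : ∀ y : F, (Ico a a').indicator (1 : ℝ → ℝ≥0∞) ‖y‖ = 0 := by
      intro y
      refine indicator_of_notMem (fun h => ?_) _
      rcases le_max_iff.1 haa with h1 | h1
      · exact absurd (h.1.trans_lt h.2) (not_lt.2 h1)
      · exact absurd (h.2.trans_le h1) (not_lt.2 (norm_nonneg y))
    simp_rw [h0, mul_zero, lintegral_zero]
    exact zero_le
  · have haa' : max a 0 ≤ a' := (not_le.1 haa).le
    have hI : ∀ y : F, (Ico a a').indicator (1 : ℝ → ℝ≥0∞) ‖y‖ = (Ico (max a 0) a').indicator 1 ‖y‖ := by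
      intro y
      have hiff : ‖y‖ ∈ Ico a a' ↔ ‖y‖ ∈ Ico (max a 0) a' := by
        simp only [mem_Ico, max_le_iff, norm_nonneg, and_true]
      by_cases h : ‖y‖ ∈ Ico a a'
      · rw [indicator_of_mem h, indicator_of_mem (hiff.1 h)]
      · rw [indicator_of_notMem h, indicator_of_notMem (fun h' => h (hiff.2 h'))]
    simp_rw [hI]
    calc ∫⁻ y, ENNReal.ofReal (gaussDensity μ y) * (Ico (max a 0) a').indicator 1 ‖y‖
        ≤ ENNReal.ofReal (meanShellConst F * (a' - max a 0)) :=
          lintegral_shell_gaussDensity_le_of_nonneg μ (le_max_right a 0) haa'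
      _ ≤ ENNReal.ofReal (meanShellConst F * (a' - a)) := by
          refine ENNReal.ofReal_le_ofReal (mul_le_mul_of_nonneg_left ?_ meanShellConst_nonneg)
          linarith [le_max_left a 0]

end Shell

section Gaussian

variable {F : Type*} [NormedAddCommGroup F] [InnerProductSpace ℝ F] [FiniteDimensional ℝ F] [MeasurableSpace F]
  [BorelSpace F]

/-! ## §2 General isotropic covariance `n²` by scaling; the standard Gaussian with a mean and a linear map -/

/-- **CORE at scale `n`**: for `n > 0`, every mean `μ` and all real `a, a′`,
`∫ 1{a ≤ ‖y‖ < a′}·(2π)^{−m/2}e^{−‖y − μ‖²/(2n²)} dy ≤ n^{m−1}·K′_m·(a′ − a)` — the substitution `y = n•w` turns the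
left side into `n^m` times the unit-covariance shell integral with mean `n⁻¹•μ` and thresholds `a/n, a′/n`. [folklore] -/
theorem lintegral_shell_scaledGaussDensity_le [Nontrivial F] {n : ℝ} (hn : 0 < n) (μ : F) (a a' : ℝ) :
    ∫⁻ y, ENNReal.ofReal (gaussConst F * rexp (-‖y - μ‖ ^ 2 / (2 * n ^ 2))) * (Ico a a').indicator 1 ‖y‖ ≤
      ENNReal.ofReal (n ^ (finrank ℝ F - 1) * meanShellConst F * (a' - a)) := by
  set m : ℕ := finrank ℝ F with hm
  have hm1 : 1 ≤ m := Module.finrank_pos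
  set g : F → ℝ≥0∞ := fun y =>
    ENNReal.ofReal (gaussConst F * rexp (-‖y - μ‖ ^ 2 / (2 * n ^ 2))) * (Ico a a').indicator 1 ‖y‖ with hg
  -- the substitution y = n • w
  have hsub : ∀ w : F, g (n • w) =
      ENNReal.ofReal (gaussDensity (n⁻¹ • μ) w) * (Ico (a / n) (a' / n)).indicator 1 ‖w‖ := by
    intro w
    have h1 : -‖n • w - μ‖ ^ 2 / (2 * n ^ 2) = -‖w - n⁻¹ • μ‖ ^ 2 / 2 := by
      have : n • w - μ = n • (w - n⁻¹ • μ) := by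
        rw [smul_sub, smul_inv_smul₀ hn.ne']
      rw [this, norm_smul, Real.norm_eq_abs, abs_of_pos hn, mul_pow]
      field_simp
    have h2 : (Ico a a').indicator (1 : ℝ → ℝ≥0∞) ‖n • w‖ = (Ico (a / n) (a' / n)).indicator 1 ‖w‖ := by
      rw [norm_smul, Real.norm_eq_abs, abs_of_pos hn]
      have hiff : n * ‖w‖ ∈ Ico a a' ↔ ‖w‖ ∈ Ico (a / n) (a' / n) := by
        rw [mem_Ico, mem_Ico, div_le_iff₀ hn, lt_div_iff₀ hn, mul_comm]
      by_cases h : n * ‖w‖ ∈ Ico a a'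
      · rw [indicator_of_mem h, indicator_of_mem (hiff.1 h)]; rfl
      · rw [indicator_of_notMem h, indicator_of_notMem (fun h' => h (hiff.2 h'))]
    simp only [hg, gaussDensity, h1, h2]
  have hscale := lintegral_comp_smul g hn.ne'
  simp_rw [hsub] at hscale
  -- solve for ∫ g
  have hpow : (0 : ℝ) < n ^ m := pow_pos hn m
  have key : ∫⁻ y, g y = ENNReal.ofReal (n ^ m) *
      ∫⁻ w, ENNReal.ofReal (gaussDensity (n⁻¹ • μ) w) * (Ico (a / n) (a' / n)).indicator 1 ‖w‖ := by
    rw [hscale, ← mul_assoc, ← ENNReal.ofReal_mul hpow.le, abs_of_pos (inv_pos.2 hpow), mul_inv_cancel₀ hpow.ne',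
      ENNReal.ofReal_one, one_mul]
  rw [key]
  calc ENNReal.ofReal (n ^ m) *
        ∫⁻ w, ENNReal.ofReal (gaussDensity (n⁻¹ • μ) w) * (Ico (a / n) (a' / n)).indicator 1 ‖w‖
      ≤ ENNReal.ofReal (n ^ m) * ENNReal.ofReal (meanShellConst F * (a' / n - a / n)) :=
        mul_le_mul' le_rfl (lintegral_shell_gaussDensity_le _ _ _)
    _ = ENNReal.ofReal (n ^ (finrank ℝ F - 1) * meanShellConst F * (a' - a)) := by
        rw [← ENNReal.ofReal_mul hpow.le, ← hm]
        congr 1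
        have hpm : n ^ m = n ^ (m - 1) * n := by rw [← pow_succ, Nat.sub_add_cancel hm1]
        rw [hpm]
        field_simp

/-- **A RADIAL SHELL OF A NON-CENTRAL STANDARD GAUSSIAN IS LINEAR IN ITS WIDTH, UNIFORMLY IN THE MEAN**: on an `m`-dimensional
real inner product space (`m ≥ 1`), for every `μ ∈ F` and all real `a, a′`,
`𝒩{z : a ≤ ‖z + μ‖ < a′} ≤ K′_m·(a′ − a)`, `K′_m = m·(1 + (2π)^{−m/2}vol(B₁)) + 2^{m/2}` — INDEPENDENT of `μ` and of `a`.
The NON-ZERO-MEAN form of residual line (R-9) of row NE9 (a `𝔤`-valued bond variable whose Gaussian law is shifted by the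
linear term of [II] (2.23)). [cite: Balaban1988RG2Cluster, (1.34) p.9, (2.3) p.12 and (2.23) p.17; Balaban1987RG1, (2.9) p.266] -/
theorem stdGaussian_radialShell_mean_le [Nontrivial F] (μ : F) (a a' : ℝ) :
    stdGaussian F {z : F | a ≤ ‖z + μ‖ ∧ ‖z + μ‖ < a'} ≤ ENNReal.ofReal (meanShellConst F * (a' - a)) := by
  set S : Set F := {z : F | a ≤ ‖z + μ‖ ∧ ‖z + μ‖ < a'} with hS
  have hSeq : S = (fun z : F => ‖z + μ‖) ⁻¹' Ico a a' := by
    ext z; simp [hS, Set.mem_Ico]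
  have hSm : MeasurableSet S := by
    rw [hSeq]; exact (continuous_id.add continuous_const).norm.measurable measurableSet_Ico
  have h1 : stdGaussian F S =
      ∫⁻ z, ENNReal.ofReal (gaussConst F * rexp (-‖z‖ ^ 2 / 2)) * (Ico a a').indicator 1 ‖z + μ‖ := by
    rw [← lintegral_indicator_one hSm, lintegral_stdGaussian_eq_lintegral_mul (measurable_one.indicator hSm)]
    refine lintegral_congr fun z => ?_
    have hind : S.indicator (1 : F → ℝ≥0∞) z = (Ico a a').indicator 1 ‖z + μ‖ := by rw [hSeq]; rfl
    rw [hind, gaussConst]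
  -- translate z = y - μ
  have h2 := lintegral_add_right_eq_self (μ := (volume : Measure F))
    (fun y : F => ENNReal.ofReal (gaussDensity μ y) * (Ico a a').indicator 1 ‖y‖) μ
  have h3 : ∀ z : F, ENNReal.ofReal (gaussConst F * rexp (-‖z‖ ^ 2 / 2)) * (Ico a a').indicator 1 ‖z + μ‖ =
      ENNReal.ofReal (gaussDensity μ (z + μ)) * (Ico a a').indicator 1 ‖z + μ‖ := by
    intro z; simp [gaussDensity]
  rw [h1]
  simp_rw [h3]
  have h4 : ∫⁻ z, ENNReal.ofReal (gaussDensity μ (z + μ)) * (Ico a a').indicator 1 ‖z + μ‖ =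
      ∫⁻ y, ENNReal.ofReal (gaussDensity μ y) * (Ico a a').indicator 1 ‖y‖ := h2
  rw [h4]
  exact lintegral_shell_gaussDensity_le μ a a'

/-- **THE CUT-OFF SHELL OF A 𝔤-VALUED BOND VARIABLE WITH AN ANISOTROPIC COVARIANCE AND A NON-ZERO MEAN**: for an invertible
linear map `A` (bond block `B(b) = A z + μ` of the fluctuation field, block covariance `AAᵀ`, mean `μ`) and all real `a, a′`,
`𝒩{z : a ≤ ‖A z + μ‖ < a′} ≤ |det A|⁻¹·‖A‖^{m−1}·K′_m·(a′ − a)` — uniformly in the mean: change of variables `y = Az`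
(`Measure.map_linearMap_addHaar_eq_smul_addHaar`), the density at `A⁻¹(y − μ)` dominated by the radial-about-`μ`
`e^{−‖y − μ‖²/(2‖A‖²)}`, translation, §5.  This REMOVES the last caveat of (R-9) (v1.1 of `NE9RadialShell`: «a NON-ZERO MEAN …
avoidable by integrating the auxiliary field X first»): print's order of integration in (2.23) may be kept.
[cite: Balaban1988RG2Cluster, (1.34) p.9, (2.3) p.12 and (2.23) p.17; Balaban1987RG1, (2.9) p.266] -/
theorem stdGaussian_affineRadialShell_le [Nontrivial F] (A : F ≃ₗ[ℝ] F) (μ : F) (a a' : ℝ) :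
    stdGaussian F {z : F | a ≤ ‖A z + μ‖ ∧ ‖A z + μ‖ < a'} ≤
      ENNReal.ofReal (|(LinearMap.det (A : F →ₗ[ℝ] F))⁻¹| *
        (‖LinearMap.toContinuousLinearMap (A : F →ₗ[ℝ] F)‖ ^ (finrank ℝ F - 1) * meanShellConst F * (a' - a))) := by
  set L : F →ₗ[ℝ] F := (A : F →ₗ[ℝ] F) with hL
  set T : F →L[ℝ] F := LinearMap.toContinuousLinearMap L with hT
  have hTapply : ∀ x, T x = A x := fun x => rfl
  have hdet : LinearMap.det L ≠ 0 := (LinearEquiv.isUnit_det' A).ne_zero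
  have hn : 0 < ‖T‖ := by
    obtain ⟨x, hx⟩ := exists_ne (0 : F)
    have hAx : A x ≠ 0 := fun h => hx (A.map_eq_zero_iff.1 h)
    have h1 : ‖A x‖ ≤ ‖T‖ * ‖x‖ := by rw [← hTapply]; exact T.le_opNorm x
    have h2 : 0 < ‖A x‖ := norm_pos_iff.2 hAx
    have h3 : 0 < ‖x‖ := norm_pos_iff.2 hx
    nlinarith [norm_nonneg T]
  set S : Set F := {y : F | a ≤ ‖y + μ‖ ∧ ‖y + μ‖ < a'} with hS
  have hSeq : S = (fun y : F => ‖y + μ‖) ⁻¹' Ico a a' := by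
    ext y; simp [hS, Set.mem_Ico]
  have hSm : MeasurableSet S := by
    rw [hSeq]; exact (continuous_id.add continuous_const).norm.measurable measurableSet_Ico
  have hLm : Measurable L := L.continuous_of_finiteDimensional.measurable
  have hpre : {z : F | a ≤ ‖A z + μ‖ ∧ ‖A z + μ‖ < a'} = L ⁻¹' S := by
    ext z; simp [hS, hL]
  have hpreM : MeasurableSet (L ⁻¹' S) := hLm hSm
  set G : F → ℝ≥0∞ := fun y => ENNReal.ofReal (gaussConst F * rexp (-‖A.symm y‖ ^ 2 / 2)) * S.indicator 1 y with hG
  have hGm : Measurable G := by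
    refine Measurable.mul ?_ (measurable_one.indicator hSm)
    have hsymm : Measurable (A.symm : F → F) := (A.symm : F →ₗ[ℝ] F).continuous_of_finiteDimensional.measurable
    exact (by unfold gaussConst; fun_prop : Measurable fun y : F =>
      ENNReal.ofReal (gaussConst F * rexp (-‖y‖ ^ 2 / 2))).comp hsymm
  -- Step 1: Gaussian measure → Lebesgue integral of G ∘ A
  have h1 : stdGaussian F (L ⁻¹' S) = ∫⁻ z, G (L z) ∂(volume : Measure F) := by
    rw [← lintegral_indicator_one hpreM, lintegral_stdGaussian_eq_lintegral_mul (measurable_one.indicator hpreM)]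
    refine lintegral_congr fun z => ?_
    have hind : (L ⁻¹' S).indicator (1 : F → ℝ≥0∞) z = S.indicator 1 (L z) := rfl
    have hz : A.symm (L z) = z := by rw [hL]; exact A.symm_apply_apply z
    rw [hind, hG]
    simp only [hz, gaussConst]
  -- Step 2: change of variables y = A z
  have h2 : ∫⁻ z, G (L z) ∂(volume : Measure F) =
      ENNReal.ofReal |(LinearMap.det L)⁻¹| * ∫⁻ y, G y ∂(volume : Measure F) := by
    rw [← lintegral_map hGm hLm, Measure.map_linearMap_addHaar_eq_smul_addHaar _ hdet, lintegral_smul_measure,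
      smul_eq_mul]
  -- Step 3: domination of the transported density by the CENTRED radial Gaussian at scale ‖T‖ (shell still shifted)
  have h3 : ∀ y, G y ≤ ENNReal.ofReal (gaussConst F * rexp (-‖y‖ ^ 2 / (2 * ‖T‖ ^ 2))) *
      (Ico a a').indicator 1 ‖y + μ‖ := by
    intro y
    have hind : S.indicator (1 : F → ℝ≥0∞) y = (Ico a a').indicator 1 ‖y + μ‖ := by rw [hSeq]; rfl
    rw [hG]
    simp only [hind]
    refine mul_le_mul' (ENNReal.ofReal_le_ofReal (mul_le_mul_of_nonneg_left ?_ gaussConst_pos.le)) le_rfl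
    apply Real.exp_le_exp.2
    have hy : ‖y‖ ≤ ‖T‖ * ‖A.symm y‖ := by
      have := T.le_opNorm (A.symm y)
      rwa [hTapply, A.apply_symm_apply] at this
    have hy2 : ‖y‖ ^ 2 ≤ ‖T‖ ^ 2 * ‖A.symm y‖ ^ 2 := by
      rw [← mul_pow]; exact pow_le_pow_left₀ (norm_nonneg _) hy 2
    have hT2 : 0 < ‖T‖ ^ 2 := by positivity
    have key : ‖y‖ ^ 2 / ‖T‖ ^ 2 ≤ ‖A.symm y‖ ^ 2 := by
      rw [div_le_iff₀ hT2, mul_comm]; exact hy2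
    have e : -‖y‖ ^ 2 / (2 * ‖T‖ ^ 2) = -(‖y‖ ^ 2 / ‖T‖ ^ 2) / 2 := by
      field_simp
    rw [e]
    linarith [key]
  -- Step 4: translation y = x − μ, then the scaled CORE with mean μ
  have h4 : ∫⁻ y, ENNReal.ofReal (gaussConst F * rexp (-‖y‖ ^ 2 / (2 * ‖T‖ ^ 2))) * (Ico a a').indicator 1 ‖y + μ‖ =
      ∫⁻ x, ENNReal.ofReal (gaussConst F * rexp (-‖x - μ‖ ^ 2 / (2 * ‖T‖ ^ 2))) * (Ico a a').indicator 1 ‖x‖ := by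
    rw [← lintegral_add_right_eq_self (μ := (volume : Measure F))
      (fun x : F => ENNReal.ofReal (gaussConst F * rexp (-‖x - μ‖ ^ 2 / (2 * ‖T‖ ^ 2))) *
        (Ico a a').indicator 1 ‖x‖) μ]
    simp only [add_sub_cancel_right]
  rw [hpre, h1, h2]
  calc ENNReal.ofReal |(LinearMap.det L)⁻¹| * ∫⁻ y, G y ∂(volume : Measure F)
      ≤ ENNReal.ofReal |(LinearMap.det L)⁻¹| *
          ∫⁻ y, ENNReal.ofReal (gaussConst F * rexp (-‖y‖ ^ 2 / (2 * ‖T‖ ^ 2))) * (Ico a a').indicator 1 ‖y + μ‖ :=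
        mul_le_mul' le_rfl (lintegral_mono h3)
    _ = ENNReal.ofReal |(LinearMap.det L)⁻¹| *
          ∫⁻ x, ENNReal.ofReal (gaussConst F * rexp (-‖x - μ‖ ^ 2 / (2 * ‖T‖ ^ 2))) * (Ico a a').indicator 1 ‖x‖ := by
        rw [h4]
    _ ≤ ENNReal.ofReal |(LinearMap.det L)⁻¹| *
          ENNReal.ofReal (‖T‖ ^ (finrank ℝ F - 1) * meanShellConst F * (a' - a)) :=
        mul_le_mul' le_rfl (lintegral_shell_scaledGaussDensity_le hn μ a a')
    _ = ENNReal.ofReal (|(LinearMap.det L)⁻¹| *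
          (‖T‖ ^ (finrank ℝ F - 1) * meanShellConst F * (a' - a))) := by
        rw [← ENNReal.ofReal_mul (abs_nonneg _)]

/-- **BETWEEN THE THRESHOLDS OF TWO COUPLINGS** (the form node U3 consumes): for `s, s′ > 0`, any real `ε₁`, any mean and any
invertible block `A`, `𝒩{ε₁/max(s,s′) ≤ ‖Az + μ‖ < ε₁/min(s,s′)} ≤ |det A|⁻¹·‖A‖^{m−1}·K′_m·ε₁|s⁻¹ − s′⁻¹|` — LINEAR in the
threshold displacement, a bounded modulus in `t = g⁻²` (`NE9CutoffShell.inv_sub_inv_le`), uniformly in the mean.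
[cite: Balaban1988RG2Cluster, (1.34) p.9 and (2.3) p.12] -/
theorem stdGaussian_affineThresholdShell_le [Nontrivial F] (A : F ≃ₗ[ℝ] F) (μ : F) (ε₁ : ℝ) {s s' : ℝ} (hs : 0 < s)
    (hs' : 0 < s') :
    stdGaussian F {z : F | ε₁ / max s s' ≤ ‖A z + μ‖ ∧ ‖A z + μ‖ < ε₁ / min s s'} ≤
      ENNReal.ofReal (|(LinearMap.det (A : F →ₗ[ℝ] F))⁻¹| *
        (‖LinearMap.toContinuousLinearMap (A : F →ₗ[ℝ] F)‖ ^ (finrank ℝ F - 1) * meanShellConst F *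
          (ε₁ * |s⁻¹ - s'⁻¹|))) := by
  rw [← NE9CutoffShell.shellWidth_eq hs hs']
  exact stdGaussian_affineRadialShell_le A μ _ _

end Gaussian

end Summit.QuantumFields.BalabanUV.T4Continuum.NE9RadialShellMean

end
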